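import Summits.HodgeConjecture.HodgeConjecture.Theorems.R90S9SphericalClassTrace   -- ★ p862484 (this seat): the factorisation law at `tens₀ S fS fT`; cone: ★ `tens₀`, `TestS₀`, `Unr₀`, `locAll`, `toPureTensor`, ★ `UnrTensor.unit`, ★ `ArchTestKc`, ★ `PureTensor.eval_eq_of_subset`
import HarnessLib

/-!
# R90-TF · S9 «InnerForm-13.3.6 (c)» — REALISING ★ p862002's BARE TEST PAIRS `(φ, (f_v)_v)` AS THE SEMILOCAL TEST FUNCTIONS `f′_{S,∞} ⊗ f^S = tens₀ S fS fT` OF RECORD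
# (the W3-b seam of R90-IF-audit1 2026-09-04T22:33:05Z: `testS₀OfPair`, `tensOfPair`, the read-back `locAll = f`, presentation independence, and ★ p862484 read on pairs)

Cell `hodgecm-mathlib`, crux H413 (`stmt-HodgeConjecture-24833`, lane `--supports … --as helper`), route of record `HCCMUnconditional` (count-neutral).  Programme R90-TF,
section S9 (base `R90-IF`); seat R90-IF-p05 (g0); PRE-AUDIT FLAG W3 of R90-IF-audit1 (g0) «`tens₀` DOES NOT EAT ★ p862002's PAIR» (R90 bus 22:33:05Z, road W3-b recommended,
owner p05), provisional TAKE 22:35Z.  DEFINITIONS + laws (`--kind definition`, review lane); no instance, no notation, no named fact, no `sorry`; never imports a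
`Cruxes/…/Lines` module; namespace `Summit.HodgeConjecture.HodgeConjecture.R90.S9`.
HONEST LABEL: HC_CM is proved only modulo the 7 printed citations (2 remaining named inputs: hLiu418 = stmt-HodgeConjecture-24832, h413 = stmt-HodgeConjecture-24833)
— until rung 0 closes.  Bookkeeping (a typing seam): proves no printed statement; §4 inherits the letters of ★ p862484 (ArchFinTraceSplit, PH), NAMED as hypotheses.

## THE SEAM
RULING S9-R-TG (22:14:33Z) pins `X_cm`'s test type to the BARE pair type of ★ p862002 ∕ ★ p862240 §1 — `(G′_∞ → ℂ) × (∀ v, G′_v → ℂ)` with the side conditions carried by the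
PREDICATE `𝓕₀ p := ArchTestKc p.1 ∧ (∀ v, IsLocallyConstant (p.2 v) ∧ HasCompactSupport (p.2 v)) ∧ {v | p.2 v ≠ 𝟙_{K_v}}.Finite` (units `e_v := 𝟙_{K_v}` un-normalised, as ★
`UnrTensor` and p04 (g2) 22:26:51Z) — and writes `X_cm.traceL := fun p => 𝔨.traceGp (tens₀ … p)`; but ★ `tens₀ (S) (fS : TestS₀ L H ι T hT S) (fT : Unr₀ L H S) : TestGp L H`
eats the SEMILOCAL data, and no tree term maps a bare pair into it.  This file supplies that map and its laws:
* `testS₀OfPair S φ f hφ hf : TestS₀ L H ι T hT S` — the `S ∪ ∞`-test datum of a pair on ANY declared bad set `S` (`arch := φ`, `loc v := f v`; the three archimedean proof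
  fields ARE the three clauses of ★ `ArchTestKc`, token for token; the finite ones are `hf`) — §1;
* the READ-BACK `locAll (testS₀OfPair S φ f …) 𝟙 = f` whenever `f_v = 𝟙_{K_v}` off `S` (★ `UnrTensor.unit` as the unramified tensor) — §1;
* PRESENTATION INDEPENDENCE: `tens₀ S′ (testS₀OfPair S′ …) 𝟙 = tens₀ S (testS₀OfPair S …) 𝟙` for `S ⊆ S′` both admissible (★ `PureTensor.eval_eq_of_subset`: same arch factor,
  same local factors `f`, integral levels) — §2;
* **`tensOfPair p : TestGp L H`** := `tens₀` of the CANONICAL presentation (`S := {v | p.2 v ≠ 𝟙_{K_v}}`) if `𝓕₀ p`, else `0` (junk off `𝓕₀` — harmless: every S9 identity is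
  consumed under the `Transfer` guard, S9-R-b′), with `tensOfPair_eq_tens₀`: `= tens₀ S (testS₀OfPair S …) 𝟙` for EVERY admissible `S` (so a consumer may enlarge `S` past any
  exceptional set `S₀`) — §3;
* §4 ★ p862484 READ ON PAIRS: for EVERY `𝓕₀`-pair `p` and every `K_c`-spherical class `π′`, `tr π′(tensOfPair p) = archTr₀ (record) p.1 · ∏ᶠ_v tr (clFinChoice (rep π′.1) v)(p.2 v)`
  — NO `S ⊇ S₀` guard survives (present `p` on `S ∪ S₀`), i.e. the class character agrees with ★ p862002's `Θ₀` at the component record ON ALL OF `𝓕₀`: the `htr` input of ★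
  p862518 `chiExpansion_gammaSph_of_allClasses_tens₀` at `X_cm`, modulo the pin `X_cm.trPrime := Θ₀ ∘ tupleOf` (p02's `tupleOf_fst` ∕ `tupleOf_snd`).
So the successor's pins read `X_cm.traceL := fun p => 𝔨.traceGp (tensOfPair … p)`, `Transfer_cm := fun p f => IsKcBiInv … (tensOfPair … p) ∧ 𝔨.Transfer (tensOfPair … p) f`,
`TransferH_cm` likewise (W3-b), and every ★ file typed at the bare pair (★ p862450 ∕ p862494 (CMP), (d2), p04's levels, ★ p862002 `hli`) stays untouched.

[cite: Rogawski1990, §14.2 p. 233; §14.5 p. 237; §14.6 p. 244] [cite: BorelJacquet1979, §4.1 and §4.6] [cite: FlathCorvallis1979, Thm. 3 and Thm. 4]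
-/

set_option autoImplicit false
-- the mandated namespace repeats `HodgeConjecture.HodgeConjecture`, as in every `Theorems/*.lean` of this sub-problem
set_option linter.dupNamespace false

noncomputable section

open NumberField IsDedekindDomain MeasureTheory Filter
open Literature.NumberTheory.Rogawski1990
open Literature.NumberTheory.Automorphic Literature.NumberTheory.Automorphic.UnitaryGroup
open Literature.NumberTheory.Automorphic.UnitaryGroup.CotangentForms
open scoped Matrix Classical

open Summit.HodgeConjecture.HodgeConjecture.Cruxes.H413
open Summit.HodgeConjecture.HodgeConjecture.Cruxes.H413.F0P3InnerFormClassificationV6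
open Summit.HodgeConjecture.HodgeConjecture.Cruxes.H413.F0P3ClassTokensOfRecord (Cls cl rep)
open Summit.HodgeConjecture.HodgeConjecture.Cruxes.H413.F0P3ClassTokenChoice (clFinChoice)
open Summit.HodgeConjecture.HodgeConjecture.Cruxes.H413.F0P3CompactTrivOfRecord (cptTriv₀)
open Summit.HodgeConjecture.HodgeConjecture.Cruxes.H413.F0P3UnitaryLocOfRecord (clInfChoiceU)
open Summit.HodgeConjecture.HodgeConjecture.Cruxes.H413.F0P3TestFunctionsOfRecord (Unr₀)
open Summit.HodgeConjecture.HodgeConjecture.Cruxes.H413.F0P3UnrTensorInstance (UnrTensor)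
open Summit.HodgeConjecture.HodgeConjecture.Cruxes.H413.F0P3SpectralSideOfRecord (trGp₀)
open Summit.HodgeConjecture.HodgeConjecture.Cruxes.H413.F0P3SemilocalTestFunctionsOfRecord
  (TestS₀ tens₀ locAll locAll_of_mem locAll_of_not_mem toPureTensor toPureTensor_S tens₀_apply)
open Summit.HodgeConjecture.HodgeConjecture.Cruxes.H413.F0P3bArchDegOneClass (archDegOneClass)
open Summit.HodgeConjecture.HodgeConjecture.Cruxes.H413.F0P3LettersTraceFactorisation (IsProductHaar)
open Summit.HodgeConjecture.HodgeConjecture.Cruxes.H413.F0P3LettersArchFinTraceSplit (ArchFinTraceSplit)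

namespace Summit.HodgeConjecture.HodgeConjecture.R90.S9

variable (L : Type) [Field L] [NumberField L] [IsCMField L] (H : Matrix (Fin 3) (Fin 3) L) (ι : L →+* ℂ) (T : GL (Fin 3) ℂ)
  (hT : (T : Matrix (Fin 3) (Fin 3) ℂ)ᴴ * H.map ι * (T : Matrix (Fin 3) (Fin 3) ℂ) = Literature.Geometry.ComplexHyperbolic.BallModel.J)

/-! ## §1 The `S ∪ ∞`-test datum of a bare pair, and the read-back of its local factors -/

/-- **The `S ∪ ∞`-test datum of a bare pair `(φ, f)` on a declared bad set `S`** (★ `TestS₀`): archimedean factor `φ` (its three proof fields = the three clauses of ★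
`ArchTestKc`, token for token), bad local factors `f_v`, `v ∈ S` (locally constant, compactly supported: `hf`).  The pair's factors off `S` are not stored (the unramified
tensor carries `𝟙_{K_v}` there); when `f_v = 𝟙_{K_v}` off `S` nothing is lost (`locAll_testS₀OfPair_unit`). [cite: Rogawski1990, §14.2 p. 233] [cite: BorelJacquet1979, §4.1] -/
def testS₀OfPair (S : Finset (Places L)) (φ : UnitaryGroup.arch (↥(maximalRealSubfield L)) L (IsCMField.complexConj L) 3 H → ℂ)
    (f : ∀ v : Places L, (cmDatum L 3 H).Local v → ℂ) (hφ : ArchTestKc L ι H T hT φ)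
    (hf : ∀ v : Places L, IsLocallyConstant (f v) ∧ HasCompactSupport (f v)) : TestS₀ L H ι T hT S where
  arch := φ
  loc v := f v.1
  isArchTest := hφ.1
  arch_mul_archPart := hφ.2.1
  arch_archPart_mul := hφ.2.2
  isLocallyConstant_loc v := (hf v.1).1
  hasCompactSupport_loc v := (hf v.1).2

variable {S : Finset (Places L)} {φ : UnitaryGroup.arch (↥(maximalRealSubfield L)) L (IsCMField.complexConj L) 3 H → ℂ}
  {f : ∀ v : Places L, (cmDatum L 3 H).Local v → ℂ} (hφ : ArchTestKc L ι H T hT φ)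
  (hf : ∀ v : Places L, IsLocallyConstant (f v) ∧ HasCompactSupport (f v))

/-- The archimedean factor of `testS₀OfPair S φ f` is `φ` (`rfl`). [cite: Rogawski1990, §14.2 p. 233] -/
@[simp] theorem testS₀OfPair_arch : (testS₀OfPair L H ι T hT S φ f hφ hf).arch = φ := rfl

/-- The bad local factor of `testS₀OfPair S φ f` at `v ∈ S` is `f v` (`rfl`). [cite: Rogawski1990, §14.2 p. 233] -/
@[simp] theorem testS₀OfPair_loc (v : ↥S) : (testS₀OfPair L H ι T hT S φ f hφ hf).loc v = f v.1 := rfl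

/-- **READ-BACK**: with the unit unramified tensor `𝟙 = ⊗_v 𝟙_{K_v}` (★ `UnrTensor.unit`), the full local-factor family ★ `locAll` of `testS₀OfPair S φ f` IS `f`, provided
`f_v = 𝟙_{K_v}` off `S`. [cite: Rogawski1990, §14.2 p. 233] [cite: BorelJacquet1979, §4.1] -/
theorem locAll_testS₀OfPair_unit
    (hS : ∀ v : Places L, v ∉ S → f v = (cmLocalIntegralLevel L 3 H v : Set ((cmDatum L 3 H).Local v)).indicator fun _ => (1 : ℂ)) :
    locAll (testS₀OfPair L H ι T hT S φ f hφ hf) (UnrTensor.unit : Unr₀ L H S) = f := by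
  funext v
  by_cases hv : v ∈ S
  · rw [locAll_of_mem _ _ hv]
    rfl
  · rw [locAll_of_not_mem _ _ hv, hS v hv]
    rfl

/-- Every local factor of the pure tensor ★ `toPureTensor S (testS₀OfPair S φ f) 𝟙` is `f v` (on `S`: the stored factor; off `S`: `𝟙_{K_v} = f v`).
[cite: Rogawski1990, §14.2 p. 233] -/
theorem toPureTensor_testS₀OfPair_unit_loc
    (hS : ∀ v : Places L, v ∉ S → f v = (cmLocalIntegralLevel L 3 H v : Set ((cmDatum L 3 H).Local v)).indicator fun _ => (1 : ℂ)) (v : Places L) :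
    (toPureTensor S (testS₀OfPair L H ι T hT S φ f hφ hf) (UnrTensor.unit : Unr₀ L H S)).loc v = f v := by
  show (if v ∈ S ∪ (UnrTensor.unit : Unr₀ L H S).T then locAll (testS₀OfPair L H ι T hT S φ f hφ hf) (UnrTensor.unit : Unr₀ L H S) v
    else (cmLocalIntegralLevel L 3 H v : Set ((cmDatum L 3 H).Local v)).indicator fun _ => (1 : ℂ)) = f v
  rw [locAll_testS₀OfPair_unit L H ι T hT hφ hf hS]
  split_ifs with h
  · rfl
  · exact (hS v fun hv => h (Finset.mem_union_left _ hv)).symm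

/-! ## §2 Presentation independence: enlarging the declared bad set does not change `f′_{S,∞} ⊗ 𝟙` -/

/-- **PRESENTATION INDEPENDENCE**: for `S ⊆ S′`, both admissible for the pair (`f_v = 𝟙_{K_v}` off `S`), the semilocal test functions of the two presentations coincide:
`tens₀ S′ (testS₀OfPair S′ φ f) 𝟙 = tens₀ S (testS₀OfPair S φ f) 𝟙` — the underlying pure tensors have the same archimedean factor, the same local factors `f` and the integral
levels, and nested bad sets (★ `PureTensor.eval_eq_of_subset`). [cite: Rogawski1990, §14.2 p. 233] [cite: BorelJacquet1979, §4.1] -/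
theorem tens₀_testS₀OfPair_unit_eq_of_subset {S S' : Finset (Places L)} (hSS' : S ⊆ S')
    (hS : ∀ v : Places L, v ∉ S → f v = (cmLocalIntegralLevel L 3 H v : Set ((cmDatum L 3 H).Local v)).indicator fun _ => (1 : ℂ)) :
    tens₀ S' (testS₀OfPair L H ι T hT S' φ f hφ hf) (UnrTensor.unit : Unr₀ L H S') =
      tens₀ S (testS₀OfPair L H ι T hT S φ f hφ hf) (UnrTensor.unit : Unr₀ L H S) := by
  have hS' : ∀ v : Places L, v ∉ S' → f v = (cmLocalIntegralLevel L 3 H v : Set ((cmDatum L 3 H).Local v)).indicator fun _ => (1 : ℂ) :=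
    fun v hv => hS v fun h => hv (hSS' h)
  have key := PureTensor.eval_eq_of_subset
    (toPureTensor S (testS₀OfPair L H ι T hT S φ f hφ hf) (UnrTensor.unit : Unr₀ L H S))
    (toPureTensor S' (testS₀OfPair L H ι T hT S' φ f hφ hf) (UnrTensor.unit : Unr₀ L H S'))
    (by
      intro v hv
      rw [toPureTensor_S, Finset.mem_union] at hv ⊢
      rcases hv with h | h
      · exact Or.inl (hSS' h)
      · exact absurd h (Finset.notMem_empty v))
    (fun _ => rfl)
    (fun v => by
      rw [toPureTensor_testS₀OfPair_unit_loc L H ι T hT hφ hf hS' v, toPureTensor_testS₀OfPair_unit_loc L H ι T hT hφ hf hS v])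
    rfl
  ext g
  rw [tens₀_apply, tens₀_apply, key]

/-! ## §3 `tensOfPair`: the bare pair as an element of `TestGp L H = C_c(G′(𝔸), ℂ)` -/

/-- **`tensOfPair p` — THE BARE TEST PAIR `p = (φ, (f_v)_v)` OF ★ p862002 AS THE TEST FUNCTION `f′ = φ ⊗ ⊗_v f_v ∈ C_c(G′(𝔸))`**: if `p` satisfies the test predicate `𝓕₀`
(★ `ArchTestKc φ`, every `f_v` locally constant with compact support, `f_v = 𝟙_{K_v}` off a finite set), `tens₀` of its CANONICAL presentation (declared bad set
`{v | f_v ≠ 𝟙_{K_v}}`, unit unramified tensor); otherwise the junk value `0` (off `𝓕₀` no S9 identity is consumed — the `Transfer` guard, S9-R-b′).  The W3-b pin: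
`X_cm.traceL := fun p => 𝔨.traceGp (tensOfPair … p)`. [cite: Rogawski1990, §14.2 p. 233] [cite: BorelJacquet1979, §4.1] -/
def tensOfPair (p : (UnitaryGroup.arch (↥(maximalRealSubfield L)) L (IsCMField.complexConj L) 3 H → ℂ) × (∀ v : Places L, (cmDatum L 3 H).Local v → ℂ)) :
    TestGp L H :=
  if h : ArchTestKc L ι H T hT p.1 ∧ (∀ v : Places L, IsLocallyConstant (p.2 v) ∧ HasCompactSupport (p.2 v)) ∧
      {v : Places L | p.2 v ≠ (cmLocalIntegralLevel L 3 H v : Set ((cmDatum L 3 H).Local v)).indicator fun _ => (1 : ℂ)}.Finite then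
    tens₀ h.2.2.toFinset (testS₀OfPair L H ι T hT h.2.2.toFinset p.1 p.2 h.1 h.2.1) (UnrTensor.unit : Unr₀ L H h.2.2.toFinset)
  else 0

variable {p : (UnitaryGroup.arch (↥(maximalRealSubfield L)) L (IsCMField.complexConj L) 3 H → ℂ) × (∀ v : Places L, (cmDatum L 3 H).Local v → ℂ)}

/-- Off the test predicate, `tensOfPair p = 0` (junk). [cite: Rogawski1990, §14.2 p. 233] -/
theorem tensOfPair_of_not
    (h : ¬ (ArchTestKc L ι H T hT p.1 ∧ (∀ v : Places L, IsLocallyConstant (p.2 v) ∧ HasCompactSupport (p.2 v)) ∧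
      {v : Places L | p.2 v ≠ (cmLocalIntegralLevel L 3 H v : Set ((cmDatum L 3 H).Local v)).indicator fun _ => (1 : ℂ)}.Finite)) :
    tensOfPair L H ι T hT p = 0 := by
  unfold tensOfPair
  rw [dif_neg h]

/-- **`tensOfPair p` IN ANY ADMISSIBLE PRESENTATION**: on the test predicate, for EVERY finite `S` off which `f_v = 𝟙_{K_v}`, `tensOfPair p = tens₀ S (testS₀OfPair S p.1 p.2) 𝟙`
(canonical presentation + §2 through `S ∪ {v | f_v ≠ 𝟙_{K_v}}`) — so a consumer may take `S ⊇` any exceptional set. [cite: Rogawski1990, §14.2 p. 233] [cite: BorelJacquet1979, §4.1] -/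
theorem tensOfPair_eq_tens₀
    (h : ArchTestKc L ι H T hT p.1 ∧ (∀ v : Places L, IsLocallyConstant (p.2 v) ∧ HasCompactSupport (p.2 v)) ∧
      {v : Places L | p.2 v ≠ (cmLocalIntegralLevel L 3 H v : Set ((cmDatum L 3 H).Local v)).indicator fun _ => (1 : ℂ)}.Finite)
    (S : Finset (Places L))
    (hS : ∀ v : Places L, v ∉ S → p.2 v = (cmLocalIntegralLevel L 3 H v : Set ((cmDatum L 3 H).Local v)).indicator fun _ => (1 : ℂ)) :
    tensOfPair L H ι T hT p = tens₀ S (testS₀OfPair L H ι T hT S p.1 p.2 h.1 h.2.1) (UnrTensor.unit : Unr₀ L H S) := by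
  have h₁ : ∀ v : Places L, v ∉ h.2.2.toFinset →
      p.2 v = (cmLocalIntegralLevel L 3 H v : Set ((cmDatum L 3 H).Local v)).indicator fun _ => (1 : ℂ) := by
    intro v hv
    by_contra hne
    exact hv (h.2.2.mem_toFinset.2 hne)
  unfold tensOfPair
  rw [dif_pos h, ← tens₀_testS₀OfPair_unit_eq_of_subset L H ι T hT h.1 h.2.1 (Finset.subset_union_left (s₂ := S)) h₁,
    tens₀_testS₀OfPair_unit_eq_of_subset L H ι T hT h.1 h.2.1 (Finset.subset_union_right (s₁ := h.2.2.toFinset)) hS]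

/-! ## §4 ★ p862484 read on pairs: the class character agrees with `Θ₀` at the component record on ALL OF `𝓕₀` -/

variable (μA : Measure (Gp L H).automorphicQuotient) [(Gp L H).IsAutomorphicMeasure μA]
  [MeasurableSpace (Gp L H).Adelic] [BorelSpace (Gp L H).Adelic]
  (ν : Measure (Gp L H).Adelic) [IsFiniteMeasureOnCompacts ν]
  (νinf : @Measure (UnitaryGroup.arch (↥(maximalRealSubfield L)) L (IsCMField.complexConj L) 3 H) (borel _))
  (μv : ∀ v : Places L, @Measure ((cmDatum L 3 H).Local v) (borel _))

/-- **THE FACTORISATION LAW ON BARE TEST PAIRS** (★ p862484 `trGp₀_tens₀_eq_archTr₀_mul_finprod_sph` through `tensOfPair`, with NO `S ⊇ S₀` guard left — present `p` on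
`S₀ ∪ {v | f_v ≠ 𝟙_{K_v}}`): for every pair `p` on the test predicate and every `K_c`-spherical class `π′ : RepPrimeSph …`,
`trGp₀ … π′.1 (tensOfPair p) = archTr₀ (clInfChoiceU … [J⁺] (rep π′.1)) p.1 · ∏ᶠ_v tr (clFinChoice (rep π′.1) v)(p.2 v)` = ★ p862002's `Θ₀` at the component record of `π′` and `p`.
Modulo the letter «ArchFinTraceSplit» and PH; `H` anisotropic.  With the pin `X_cm.trPrime := Θ₀ ∘ tupleOf` this is the `htr` input of ★ p862518 at `X_cm`.
[cite: Rogawski1990, §14.5 p. 237; §14.6 Thm. 14.6.4 p. 244] [cite: FlathCorvallis1979, Thm. 3 and Thm. 4] [cite: BorelJacquet1979, §4.6] -/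
theorem trGp₀_tensOfPair_eq_archTr₀_mul_finprod_sph
    (hanis : ∀ x : Fin 3 → L, Literature.AlgebraicGeometry.ShimuraVarieties.hermForm (cmConjRingHom L) H x x = 0 → x = 0)
    (hAFS : ArchFinTraceSplit L H ι T hT μA ν νinf μv) (hPH : IsProductHaar L H ν νinf μv)
    (p : (UnitaryGroup.arch (↥(maximalRealSubfield L)) L (IsCMField.complexConj L) 3 H → ℂ) × (∀ v : Places L, (cmDatum L 3 H).Local v → ℂ))
    (h : ArchTestKc L ι H T hT p.1 ∧ (∀ v : Places L, IsLocallyConstant (p.2 v) ∧ HasCompactSupport (p.2 v)) ∧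
      {v : Places L | p.2 v ≠ (cmLocalIntegralLevel L 3 H v : Set ((cmDatum L 3 H).Local v)).indicator fun _ => (1 : ℂ)}.Finite)
    (π' : InnerFormSec146.RepPrimeSph L ι H T hT μA) :
    trGp₀ (Gp L H) μA ν π'.1 (tensOfPair L H ι T hT p) =
      UnitaryGroup.archTr₀ L ι H T hT νinf (clInfChoiceU L H ι T hT μA (archDegOneClass 1 (Or.inl rfl)) (rep (Gp L H) μA π'.1)) p.1 *
        ∏ᶠ v : Places L, (letI : MeasurableSpace ((cmDatum L 3 H).Local v) := borel _;
          (clFinChoice (rep (Gp L H) μA π'.1) v).smoothTrace (μv v) (p.2 v)) := by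
  obtain ⟨S₀, hS₀⟩ := trGp₀_tens₀_eq_archTr₀_mul_finprod_sph L H ι T hT μA ν νinf μv hanis hAFS hPH
  have hS : ∀ v : Places L, v ∉ S₀ ∪ h.2.2.toFinset →
      p.2 v = (cmLocalIntegralLevel L 3 H v : Set ((cmDatum L 3 H).Local v)).indicator fun _ => (1 : ℂ) := by
    intro v hv
    by_contra hne
    exact hv (Finset.mem_union_right _ (h.2.2.mem_toFinset.2 hne))
  rw [tensOfPair_eq_tens₀ L H ι T hT h (S₀ ∪ h.2.2.toFinset) hS,
    hS₀ (S₀ ∪ h.2.2.toFinset) Finset.subset_union_left π' _ _,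
    locAll_testS₀OfPair_unit L H ι T hT h.1 h.2.1 hS]
  rfl

end Summit.HodgeConjecture.HodgeConjecture.R90.S9

end
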